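import Summits.ResolutionOfSingularities.ResolutionOfSingularities.Theses.RuledResidues
import Summits.ResolutionOfSingularities.ResolutionOfSingularities.Theorems.RuledResiduesNonRuledCofiniteStubFiniteRegularAtlas
import Summits.ResolutionOfSingularities.ResolutionOfSingularities.Theorems.RuledResiduesNonRuledCofiniteStubExceptionalCentre
import Summits.ResolutionOfSingularities.ResolutionOfSingularities.Theorems.RuledResiduesNonRuledCofiniteStubExceptionalPrimesFinite
import Literature.AlgebraicGeometry.Resolution.DivisorialPlace
import HarnessLib

/-!
# `RuledResidues.NonRuledCofinite` (crux stmt-ResolutionOfSingularities-18076) — proved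

Route `ResolutionOfSingularities/RuledResidues`, crux 3: **exceptional primes are finite** — for
an affine model `R ⊆ K` over `k` (`R` finitely generated, `Frac R = K`) with
`Scheme.HasResolution (Spec R)`, the set of divisorial places `W ⊇ R` of `K/k` centred in
`Sing R` and dominating no regular local ring of dimension `≥ 2` of an affine model is finite.

Line `regular-atlas` (lead `prover-line-stmt-ResolutionOfSingularities-18076-0`, skeleton
`Cruxes/NonRuledCofinite/Lines/regular_atlas.lean` by the crux strategist), assembled from its
three landed stubs:

* `stub_finiteRegularAtlas` (`…StubFiniteRegularAtlas.lean`) — the resolution yields finitely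
  many finitely generated REGULAR charts `B ⊇ R` inside `K` such that every valuation ring over
  `R` contains one (valuative criterion of properness on a finite affine cover of the integral,
  quasi-compact resolution; uniqueness of injective `R`-embeddings into `Frac R`);
* `stub_exceptionalCentre` (`…StubExceptionalCentre.lean`) — on a regular chart `B ⊆ W`, an
  exceptional `W` is the place `B_𝔭` of its centre `𝔭`, a height-one prime;
* `stub_exceptionalPrimesFinite` (`…StubExceptionalPrimesFinite.lean`) — a birational chart
  `R ≤ B` has only finitely many height-one primes `𝔭` with `B_𝔭` regular and `R_{𝔭 ∩ R}` not.

Composition (`nonRuledCofinite_proof`): the crux set lies in the finite union, over the charts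
`B` and their exceptional primes `𝔭`, of the subsingletons `{W | W = B_𝔭 elementwise}`. The
divisorial conjuncts (`k ⊆ W`, DVR, essentially of finite type) are not used (refuter's mutation
note: the superset cut out by the singular-centre and no-good-model clauses is already finite).
-/

noncomputable section

set_option linter.dupNamespace false

open AlgebraicGeometry IsLocalRing
open Literature.AlgebraicGeometry.Resolution

namespace Summit.ResolutionOfSingularities.ResolutionOfSingularities.Theorems.RuledResiduesNonRuledCofinite

/-! ## Glue lemmas -/

/-- The centre of `W` on `R ≤ B ⊆ W` is the contraction of its centre on `B`. [folklore] -/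
theorem comap_centreIdeal_eq {k K : Type} [Field k] [Field K] [Algebra k K] {R B : Subalgebra k K}
    (hRB : R ≤ B) (W : ValuationSubring K) (hBW : B.toSubring ≤ W.toSubring)
    (hRW : R.toSubring ≤ W.toSubring) :
    (centreIdeal B W hBW).comap (Subalgebra.inclusion hRB).toRingHom =
      Ideal.comap (Subring.inclusion hRW) (IsLocalRing.maximalIdeal W) := by
  ext x
  simp only [centreIdeal, Ideal.mem_comap]
  exact Iff.rfl

/-! ## The crux -/

/-- **`NonRuledCofinite` (crux 3 of route `RuledResidues`): exceptional primes are finite.**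
For fields `k ⊆ K` and an affine model `R` of `K/k` with `Scheme.HasResolution (Spec R)`, the
divisorial places `W ⊇ R` centred in `Sing R` that dominate no regular local ring of dimension
`≥ 2` of an affine model of `K` form a finite set: it is contained in the finite union, over the
finitely many regular charts `B` of `stub_finiteRegularAtlas` and the finitely many exceptional
height-one primes `𝔭` of each chart (`stub_exceptionalPrimesFinite`), of the subsingletons
`{W | W = B_𝔭}` (membership by `stub_exceptionalCentre`). [folklore] -/
theorem nonRuledCofinite_proof :
    Summit.ResolutionOfSingularities.ResolutionOfSingularities.Theses.RuledResidues.NonRuledCofinite := by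
  intro k K _ _ _ R hR hfr hres
  classical
  obtain ⟨𝓑, h𝓑fin, h𝓑, hcov⟩ := stub_finiteRegularAtlas k K R hR hfr hres
  -- the exceptional places seen from the chart `B`
  let E : Subalgebra k K → Set (ValuationSubring K) := fun B =>
    {W | B.toSubring ≤ W.toSubring ∧
      (∃ h : R.toSubring ≤ W.toSubring, ¬ IsRegularLocalRing (Localization.AtPrime
        (Ideal.comap (Subring.inclusion h) (IsLocalRing.maximalIdeal W)))) ∧
      ¬ ∃ A : Subalgebra k K, A.FG ∧ IsFractionRing A K ∧ ∃ h : A.toSubring ≤ W.toSubring,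
        IsRegularLocalRing (Localization.AtPrime
          (Ideal.comap (Subring.inclusion h) (IsLocalRing.maximalIdeal W))) ∧
        (2 : WithBot ℕ∞) ≤ ringKrullDim (Localization.AtPrime
          (Ideal.comap (Subring.inclusion h) (IsLocalRing.maximalIdeal W)))}
  have hE : ∀ B ∈ 𝓑, (E B).Finite := by
    intro B hB
    obtain ⟨hRB, hBfg, hBreg⟩ := h𝓑 B hB
    have hBfr : IsFractionRing B K := isFractionRing_of_le hRB hfr
    -- the places `B_𝔭`, `𝔭` an exceptional height-one prime of the chart
    let P : PrimeSpectrum B → Set (ValuationSubring K) := fun 𝔭 =>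
      {W | ∀ z : K, z ∈ W ↔ ∃ a s : B, s ∉ 𝔭.asIdeal ∧ z = a / s}
    have hT := stub_exceptionalPrimesFinite k K R B hRB hR hBfg hfr
    refine Set.Finite.subset (hT.biUnion (t := P) fun 𝔭 _ => ?_) ?_
    · refine Set.Subsingleton.finite ?_
      intro W hW W' hW'
      ext z
      exact (hW z).trans (hW' z).symm
    · rintro W ⟨hBW, hsing, hexc⟩
      obtain ⟨hht, hmem⟩ := stub_exceptionalCentre k K R B hRB hBfg hBfr hBreg W hBW hsing hexc
      obtain ⟨hRW, hnreg⟩ := hsing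
      haveI := hBreg
      have hregp : IsRegularLocalRing (Localization.AtPrime (centreIdeal B W hBW)) := inferInstance
      have hnregp : ¬ IsRegularLocalRing (Localization.AtPrime
          ((centreIdeal B W hBW).comap (Subalgebra.inclusion hRB).toRingHom)) := by
        rwa [isRegularLocalRing_localizationAtPrime_congr (comap_centreIdeal_eq hRB W hBW hRW)]
      exact Set.mem_biUnion (x := (⟨centreIdeal B W hBW, inferInstance⟩ : PrimeSpectrum B))
        ⟨hht, hregp, hnregp⟩ hmem
  refine Set.Finite.subset (h𝓑fin.biUnion hE) ?_
  rintro W ⟨-, -, -, ⟨hRW, hnr⟩, hexc⟩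
  obtain ⟨B, hB, hBW⟩ := hcov W hRW
  exact Set.mem_biUnion hB ⟨hBW, ⟨hRW, hnr⟩, hexc⟩

end Summit.ResolutionOfSingularities.ResolutionOfSingularities.Theorems.RuledResiduesNonRuledCofinite

end
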